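import Literature.NumberTheory.NumberFields.QuadraticExtensionPlacesProofs
import Mathlib.RingTheory.Frobenius
import Mathlib.FieldTheory.Finite.Basic
import HarnessLib

/-!
# The Frobenius of a quadratic Galois extension at an inert place is the non-trivial automorphism

Topic `NumberTheory/NumberFields` (namespace `Literature.NumberTheory.NumberFields`). PROOFS ONLY (no definition, no named
fact, no `sorry`). Sequel of `QuadraticExtensionPlacesProofs` (`L/K` quadratic Galois with a given `τ ≠ 1`):

* `card_le_of_forall_pow_eq` — a finite field (indeed any finite domain) in which every element satisfies `y^q = y` (`q ≥ 2`) has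
  at most `q` elements (roots of `X^q − X`).
* **`isArithFrobAt_of_inertiaDeg_eq_two`** — if `w` has residue degree `2` over `v = w ∩ 𝓞 K`, then `τ` is an arithmetic Frobenius
  at `w` (Mathlib `IsArithFrobAt`: `τ x ≡ x^{N(v)} (mod w)` for all `x ∈ 𝓞 L`): a Frobenius exists in `Gal(L/K) = {1, τ}`
  (`IsArithFrobAt.exists_of_isInvariant`), and it is not `1` since `#(𝓞 L / w) = N(v)² > N(v)`.
* `smul_sub_pow_absNorm_mem_of_inertiaDeg_eq_two` — the congruence `τ • x − x^{N(v)} ∈ w` spelled out.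

Requested by route `BiquadraticEisensteinDescent` of `Summits/BirchSwinnertonDyer` (crux `EisensteinHeartFlatCMInertBadKPrime`, hypothesis (L),
side condition `hdeg` of `…DeuringOverKPrime.polynomial_identity`: in the biquadratic field `L = K_CM·K′` a prime of `K′` inert in `L/K′` has
residue degree `1` over `ℚ` — apply the congruence to `√d_CM`, on which `τ` acts by `−1`).

References: [NeukirchANT1999] Ch. I §9 (9.4)–(9.6) (decomposition group onto the residue Galois group, Frobenius); [Marcus2018] Ch. 4
(Thm. 28 and the Frobenius automorphism).
-/

noncomputable section

open scoped NumberField Pointwise Polynomial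
open NumberField IsDedekindDomain Polynomial
open Literature.NumberTheory.Automorphic

namespace Literature.NumberTheory.NumberFields

/-- In a finite field in which every element satisfies `y^q = y` (`q ≥ 2`) there are at most `q` elements (they are roots of
`X^q − X`). [cite: Marcus2018, Ch. 4 (proof of Thm. 28)] -/
theorem card_le_of_forall_pow_eq {F : Type*} [Field F] [Fintype F] {q : ℕ} (hq : 1 < q)
    (h : ∀ y : F, y ^ q = y) : Fintype.card F ≤ q := by
  classical
  have hp0 : (X ^ q - X : F[X]) ≠ 0 := FiniteField.X_pow_card_sub_X_ne_zero F hq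
  have hsub : (Finset.univ : Finset F) ⊆ (X ^ q - X : F[X]).roots.toFinset := fun y _ ↦ by
    rw [Multiset.mem_toFinset, mem_roots hp0, IsRoot, eval_sub, eval_pow, eval_X, h y, sub_self]
  calc Fintype.card F = (Finset.univ : Finset F).card := Finset.card_univ.symm
    _ ≤ (X ^ q - X : F[X]).roots.toFinset.card := Finset.card_le_card hsub
    _ ≤ Multiset.card (X ^ q - X : F[X]).roots := Multiset.toFinset_card_le _
    _ ≤ (X ^ q - X : F[X]).natDegree := card_roots' _
    _ = q := FiniteField.X_pow_card_sub_X_natDegree_eq F hq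

variable {K L : Type} [Field K] [Field L] [NumberField K] [NumberField L] [Algebra K L] [IsGalois K L]

omit [NumberField L] [IsGalois K L] in
/-- `#(𝓞 K / (w ∩ 𝓞 K)) = N(w ∩ 𝓞 K)`, the modulus in Mathlib's `IsArithFrobAt`. [cite: NeukirchANT1999, Ch. I §9 (9.4)] -/
theorem natCard_quotient_under_eq_absNorm (w : HeightOneSpectrum (𝓞 L)) :
    Nat.card (𝓞 K ⧸ w.asIdeal.under (𝓞 K)) = Ideal.absNorm (w.under (𝓞 K)).asIdeal := by
  rw [Ideal.absNorm_apply, Submodule.cardQuot_apply, HeightOneSpectrum.under_asIdeal]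

/-- **At a place of residue degree `2` the Frobenius of the quadratic Galois extension `L/K` is `τ`**: `τ x ≡ x^{N(v)} (mod w)` for
all `x ∈ 𝓞 L`, `v = w ∩ 𝓞 K` (Mathlib `IsArithFrobAt (𝓞 K) τ w.asIdeal`). The Frobenius exists in `Gal(L/K) = {1, τ}` and is not the
identity: otherwise every element of the residue field `𝓞 L / w` (of order `N(w) = N(v)²`) would satisfy `y^{N(v)} = y`.
[cite: NeukirchANT1999, Ch. I §9 (9.4)–(9.6)] [cite: Marcus2018, Ch. 4 Thm. 28] -/
theorem isArithFrobAt_of_inertiaDeg_eq_two (h2 : Module.finrank K L = 2) {τ : L ≃ₐ[K] L} (hτ : τ ≠ 1)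
    {w : HeightOneSpectrum (𝓞 L)} (hf : w.asIdeal.inertiaDeg (𝓞 K) = 2) : IsArithFrobAt (𝓞 K) τ w.asIdeal := by
  classical
  haveI := w.isPrime
  haveI : w.asIdeal.IsMaximal := w.isMaximal
  haveI : Finite (𝓞 L ⧸ w.asIdeal) := Ideal.finiteQuotientOfFreeOfNeBot w.asIdeal w.ne_bot
  haveI hG : IsGaloisGroup (L ≃ₐ[K] L) (𝓞 K) (𝓞 L) := IsGaloisGroup.of_isFractionRing _ _ _ K L
  haveI : Algebra.IsInvariant (𝓞 K) (𝓞 L) (L ≃ₐ[K] L) := hG.isInvariant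
  obtain ⟨σ, hσ⟩ := IsArithFrobAt.exists_of_isInvariant (𝓞 K) (L ≃ₐ[K] L) w.asIdeal
  rcases algEquiv_eq_one_or_eq_of_finrank_eq_two h2 hτ σ with rfl | rfl
  · -- `σ = 1` is impossible: the residue field would have at most `N(v)` elements
    exfalso
    set q : ℕ := Ideal.absNorm (w.under (𝓞 K)).asIdeal with hq
    have hq1 : 1 < q := by
      have h0 : q ≠ 0 := fun h ↦ (w.under (𝓞 K)).ne_bot (Ideal.absNorm_eq_zero_iff.mp h)
      have h1 : q ≠ 1 := fun h ↦ (w.under (𝓞 K)).isPrime.ne_top (Ideal.absNorm_eq_one_iff.mp h)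
      omega
    letI : Field (𝓞 L ⧸ w.asIdeal) := Ideal.Quotient.field w.asIdeal
    letI : Fintype (𝓞 L ⧸ w.asIdeal) := Fintype.ofFinite _
    have hall : ∀ y : 𝓞 L ⧸ w.asIdeal, y ^ q = y := by
      intro y
      obtain ⟨x, rfl⟩ := Ideal.Quotient.mk_surjective y
      have hx := hσ x
      rw [MulSemiringAction.toAlgHom_apply, one_smul, natCard_quotient_under_eq_absNorm, ← hq] at hx
      rw [← map_pow, eq_comm, Ideal.Quotient.eq]
      exact hx
    have hle := card_le_of_forall_pow_eq hq1 hall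
    have hcard : Fintype.card (𝓞 L ⧸ w.asIdeal) = q ^ 2 := by
      rw [← Nat.card_eq_fintype_card, ← Submodule.cardQuot_apply, ← Ideal.absNorm_apply,
        absNorm_eq_pow_inertiaDeg_under' rfl, hf]
    rw [hcard] at hle
    nlinarith
  · exact hσ
where
  /-- local copy of `N(w) = N(v)^{f(w|v)}` (`EllipticCurves.absNorm_eq_pow_inertiaDeg_under`, not importable here without a cycle risk) -/
  absNorm_eq_pow_inertiaDeg_under' {w : HeightOneSpectrum (𝓞 L)} {v : HeightOneSpectrum (𝓞 K)} (hw : w.under (𝓞 K) = v) :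
      Ideal.absNorm w.asIdeal = Ideal.absNorm v.asIdeal ^ w.asIdeal.inertiaDeg (𝓞 K) := by
    haveI : w.asIdeal.LiesOver v.asIdeal := ⟨by rw [← hw]; rfl⟩
    haveI := v.isMaximal
    haveI := w.isMaximal
    rw [Ideal.absNorm_eq_pow_inertiaDeg'_of_liesOver w.asIdeal v.asIdeal v.isPrime v.ne_bot,
      Ideal.inertiaDeg'_eq_inertiaDeg v.asIdeal w.asIdeal]

/-- **The Frobenius congruence at an inert place**: `τ • x − x^{N(v)} ∈ w` for every `x ∈ 𝓞 L`, when `w ∣ v` has residue degree `2`.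
[cite: NeukirchANT1999, Ch. I §9 (9.4)–(9.6)] -/
theorem smul_sub_pow_absNorm_mem_of_inertiaDeg_eq_two (h2 : Module.finrank K L = 2) {τ : L ≃ₐ[K] L} (hτ : τ ≠ 1)
    {w : HeightOneSpectrum (𝓞 L)} {v : HeightOneSpectrum (𝓞 K)} (hw : w.under (𝓞 K) = v)
    (hf : w.asIdeal.inertiaDeg (𝓞 K) = 2) (x : 𝓞 L) :
    τ • x - x ^ Ideal.absNorm v.asIdeal ∈ w.asIdeal := by
  have h := isArithFrobAt_of_inertiaDeg_eq_two h2 hτ hf x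
  rw [natCard_quotient_under_eq_absNorm, hw] at h
  exact h

end Literature.NumberTheory.NumberFields

end
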